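import Mathlib
import Literature.AlgebraicGeometry.Resolution.AugmentationIdeal
import Literature.AlgebraicGeometry.Resolution.AffineBlowup
import Literature.AlgebraicGeometry.Resolution.FiniteQuotientSingularityPresentation
import Summits.ResolutionOfSingularities.ResolutionOfSingularities.Theorems.WildQuotientsWildQuotientResolutionFixedPointsGraded
import Summits.ResolutionOfSingularities.ResolutionOfSingularities.Theorems.WildQuotientsWildQuotientResolutionInvolutionOnInvariants
import Summits.ResolutionOfSingularities.ResolutionOfSingularities.Theorems.WildQuotientsWildQuotientResolutionInvolutionBlowupRegular

/-!
# K–L twice, step 2 on the ring of `σ`-invariants (card `mu2-strata-kl-twice`, (ii) applied)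

(crux stmt-ResolutionOfSingularities-15640 `WildQuotients.WildQuotientResolution`, line `Sketch`,
sector `|G| = p`; RUNG V5 of `L/w45c/CHAIN.md` v8.5, brick B7/`HP₂`; res-L1-w45c-plan-1 RULING
HP₂ DIVISION 2026-08-27T13:49:46Z: res-type-036's ring side applies (ii) with
`R := V = U₂^{σ_U}`, `ι := τ̄` (`exists_restrict_fixedPoints`), `R₀ := V^{τ̄}`, `j :=` inclusion.
[OURS · L1 W4.5c] — NOT a statement of any manuscript; replaces the role of no printed item.
Prover res-L1-w45c-stub-3.)

* `isUnit_two_fixedPoints` — `2` is a unit of `U^{⟨σ⟩}` when `2 ≠ 0` in `k`;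
* **`isRegular_affineBlowup_comap_augIdeal_twice`** — for a domain `U` of finite type over a field
  `k` with `2 ≠ 0`, `σ` a `k`-automorphism with `σ ^ p = 1` (`p` prime) whose ring of invariants
  `V = U^{⟨σ⟩}` is REGULAR (K–L, first step), and `τ̄` a `k`-automorphism of `V` restricting an
  involution `τ` of `U`, the blow-up of `Spec V^{⟨τ̄⟩}` along `I_{τ̄} ∩ V^{⟨τ̄⟩}` is a regular scheme
  — `isRegular_affineBlowup_comap_augIdeal_fixedPoints` with its instance hypotheses discharged
  (`V` a domain; of finite type over `k` by Noether `finiteType_fixedPointsSubalgebra`).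
-/

-- single-problem summit: the doubled namespace component `ResolutionOfSingularities` is forced
set_option linter.dupNamespace false

noncomputable section

open AlgebraicGeometry Literature.AlgebraicGeometry.Resolution

namespace Summit.ResolutionOfSingularities.ResolutionOfSingularities.Theorems.WildQuotientResolution.InvolutionExit

/-- `2` is a unit of the ring of invariants `U^{⟨σ⟩}` as soon as `2 ≠ 0` in the field `k`.
[folklore] -/
theorem isUnit_two_fixedPoints {k U : Type} [Field k] [CommRing U] [Algebra k U] (σ : U ≃ₐ[k] U)
    (h2 : (2 : k) ≠ 0) : IsUnit (2 : FixedPoints.subalgebra k U (Subgroup.zpowers σ)) := by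
  have h := (IsUnit.mk0 (2 : k) h2).map
    (algebraMap k (FixedPoints.subalgebra k U (Subgroup.zpowers σ)))
  rwa [map_ofNat] at h

/-- **K–L twice, second step, on the invariants of the first.** Let `U` be a domain of finite type
over a field `k` with `2 ≠ 0` in `k`, `σ` a `k`-automorphism of `U` with `σ ^ p = 1` (`p` prime)
whose ring of invariants `V := U^{⟨σ⟩}` is regular, `τ` an involution of `U` and `τ̄` a
`k`-automorphism of `V` with `τ̄ v = τ v` (e.g. `exists_restrict_fixedPoints` when `στ = τσ`). Then
`Bl_{I_{τ̄} ∩ V^{⟨τ̄⟩}}(Spec V^{⟨τ̄⟩})` — `affineBlowup ((augIdeal τ̄).comap (V^{⟨τ̄⟩} ↪ V))` — is a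
regular scheme ((ii) `isRegular_affineBlowup_comap_augIdeal_fixedPoints`).
[OURS · L1 W4.5c, card `mu2-strata-kl-twice` (ii) applied; res-L1-w45c-plan-1 RULING 13:49:46Z] -/
theorem isRegular_affineBlowup_comap_augIdeal_twice {k U : Type} [Field k] [CommRing U]
    [IsDomain U] [Algebra k U] [Algebra.FiniteType k U] (h2 : (2 : k) ≠ 0) (σ τ : U ≃ₐ[k] U)
    {p : ℕ} (hp : p.Prime) (hσp : σ ^ p = 1) (hτ : ∀ u, τ (τ u) = u)
    [IsRegularRing (FixedPoints.subalgebra k U (Subgroup.zpowers σ))]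
    (τbar : FixedPoints.subalgebra k U (Subgroup.zpowers σ) ≃ₐ[k]
      FixedPoints.subalgebra k U (Subgroup.zpowers σ))
    (hτbar : ∀ v, ((τbar v : FixedPoints.subalgebra k U (Subgroup.zpowers σ)) : U) = τ v) :
    Scheme.IsRegular (affineBlowup ((augIdeal τbar).comap
      (algebraMap (FixedPoints.subalgebra k (FixedPoints.subalgebra k U (Subgroup.zpowers σ))
        (Subgroup.zpowers τbar)) (FixedPoints.subalgebra k U (Subgroup.zpowers σ))))) := by
  haveI : Finite (Subgroup.zpowers σ) :=
    Set.finite_coe_iff.mpr (isOfFinOrder_iff_pow_eq_one.mpr ⟨p, hp.pos, hσp⟩).finite_zpowers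
  haveI : Algebra.FiniteType k (FixedPoints.subalgebra k U (Subgroup.zpowers σ)) := inferInstance
  exact isRegular_affineBlowup_comap_augIdeal_fixedPoints τbar
    (restrict_involutive σ τ τbar hτbar hτ) (isUnit_two_fixedPoints σ h2)

end Summit.ResolutionOfSingularities.ResolutionOfSingularities.Theorems.WildQuotientResolution.InvolutionExit

end
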